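import Literature.AlgebraicGeometry.Motives.JacobianAbelSumFibres
import Literature.AlgebraicGeometry.Motives.AbelianVarietyIsogenyProofs
import Literature.AlgebraicGeometry.HodgeTheory.CurveHodgeGenusBound
import Literature.AlgebraicGeometry.Motives.VarietiesGeometricallyIntegralProofs
import Literature.AlgebraicGeometry.Motives.VarietiesProperProofs
import Literature.AlgebraicGeometry.Resolution.ResolutionOfCurves
import Literature.Topology.KrullDimensionDrop
import HarnessLib

/-!
# The dense open of Step I for an ABSTRACT complex Jacobian (no Abel theorem, no identification `Jac ≅ J`):
# general points of `J` are `g`-fold Abel sums of `g` distinct points, unique up to order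
# (Milne, *Jacobian Varieties*, §5 Thm. 5.1 (a), §6 Lemma 6.7; Lange 2023, §4.4.2 Lemma 4.4.4 Step I)

Layer `Literature/AlgebraicGeometry/Motives`, namespace `Literature.AlgebraicGeometry.Motives.Jacobian`.
KERNEL ONLY: theorems; no definition, no named fact, no instance, no `sorry`.

The socket **`hopen`** of ★ A-p02 (g15)'s `Motives/JacobianStepOneOfLeaves` (`exists_open_ajSum_classPullback_shear_of_leaves`), at
`r + 1 = g`: «there is a non-empty open `U₁ ⊆ J` such that every `a ∈ J(ℂ)` with `a.pt ∈ U₁` is `∏ⱼ α_P(τⱼ)` for an INJECTIVE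
`τ : Fin g → C(ℂ)`, unique up to a permutation».  On WEIL'S MODEL it is ★ `WeilJacobian.exists_opens_general_sum` (A-p03 (g13)); here it is
produced for ANY Jacobian `𝒥 : Jacobian C` of a smooth projective complex curve, WITHOUT Abel's theorem and WITHOUT knowing that Weil's
`Jac` has the universal property.  The two halves use different inputs:

* UNIQUENESS∕INJECTIVITY transport along the Albanese factorisation `u : 𝒥.J → Jac` of `f_J` alone (★ `Motives/JacobianAbelSumFibres`);
* EXISTENCE — **`Jacobian.surjective_prod_coord_abelJacobi`: the `g`-fold Abel sum `Σ_g : C^g → J`, `(τⱼ) ↦ ∏ⱼ α_R(τⱼ)`, is SURJECTIVE** —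
  by a DIMENSION COUNT: `dim J = g` over `ℂ` (★ `Jacobian.dim_le_curveGenus`, Hodge theory, + ★ `curveGenus_le_jacobian_dim`); the image
  `Z = Σ_g(C^g)` is closed (`C^g` proper) and `u` maps it ONTO `Jac` (★ `exists_tuple_prod_comp_fJ_eq`), so the reduced closed subscheme on `Z`
  surjects onto `Jac` by a universally closed map and `dim Z ≥ dim Jac = g` (★ `Scheme.topologicalKrullDim_le_of_universallyClosed_of_surjective`);
  a closed subset of the irreducible `J` of dimension `≥ dim J` is everything (★ `Topology.topologicalKrullDim_lt_of_isClosed_ssubset`).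
  (`u(a) = ∏ f_J(τⱼ) = u(∏ α_R(τⱼ))` alone would only give `a ≡ ∏ α_R(τⱼ)` modulo `ker u` — Abel; the dimension count avoids it.)

Main results: `Jacobian.surjective_prod_coord_abelJacobi` / `exists_tuple_prod_comp_abelJacobi_eq` (Σ_g onto, any base point) and
**`Jacobian.exists_opens_general_abelSum`** (= `hopen` at `Fin g`, Weil data explicit) / **`Jacobian.exists_opens_general_abelSum'`**
(`g := curveGenus C`, data discharged: the form the G4 skeleton's `stub_open` consumes, with `Fin (curveGenus C)`).

Cell `hodgecm-mathlib` (D-0151), crux HLiu418 = stmt-HodgeConjecture-24832, road G4 ∕ (E), socket (i) `hopen` (architect 08:40:07Z, pen #7 (c)(i)).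
COUNT-NEUTRAL capital; HC_CM is proved only modulo the 7 printed citations until rung 0 closes.

## References
* [Milne1986JacobianVarieties] J. S. Milne, *Jacobian Varieties* (1986), §2 Prop. 2.1 (`dim J = g`), §5 Thm. 5.1 (a) (`f^{(g)} : C^{(g)} → J` is
  surjective and birational; injective on `ℓ = 1`), §6 Prop. 6.1 and Lemma 6.7 (the open `U`), §7 Thm. 7.1.
* [Lange2023AbelianVarietiesComplex] H. Lange, *Abelian Varieties over the Complex Numbers* (2023), §4.4.2 Lemma 4.4.4 (Step I: general `x`,
  `g` pairwise different points, `h⁰ = 1`), §4.2.1 Lemma 4.2.1 (`W̃_g = J`).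
-/

set_option autoImplicit false

noncomputable section

universe u

open CategoryTheory CategoryTheory.Limits AlgebraicGeometry MonoidalCategory CartesianMonoidalCategory MonObj TopologicalSpace
open Literature.NumberTheory.DiophantineGeometry
open Literature.NumberTheory.DiophantineGeometry.AlgFunctionField
open Literature.AlgebraicGeometry.RelativeSpec

namespace Literature.AlgebraicGeometry.Motives

open RatFn FieldPoint CartierDivisor CurvePlaces WeilJacobian

namespace Jacobian

/-! ## §1 Products along the coordinates of `C^g` (any field) -/

section Coord

variable {k : Type u} [Field k] {C : SchemeOver k} (𝒥 : Jacobian C)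

/-- A `T`-valued point `ω` of `Cᵍ` followed by `Σ_g := ∏ⱼ prⱼ ≫ α_R` is `∏ⱼ α_R(prⱼ(ω))` (★ `comp_prod`; Milne's `f^g(P₁,…,P_g) = Σ f(Pᵢ)`).
[cite: Milne1986JacobianVarieties, §5 (the maps f^r : C^r → J)] -/
theorem comp_prod_coord_abelJacobi [IsIntegral C.left] [SmoothOfRelativeDimension 1 C.hom] [IsProper C.hom] [GeometricallyIntegral C.hom]
    (R : AlgPoints C k) {g : ℕ} {T : SchemeOver k} (ω : T ⟶ powC C g) :
    ω ≫ (∏ j, coord C g j ≫ 𝒥.abelJacobi R) = ∏ j, (ω ≫ coord C g j) ≫ 𝒥.abelJacobi R := by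
  rw [comp_prod]
  simp only [Category.assoc]

end Coord

/-! ## §2 `Σ_g : C^g → J` is surjective for a complex Jacobian (dimension count) -/

variable {C : SchemeOver ℂ} [IsIntegral C.left] [SmoothOfRelativeDimension 1 C.hom] [IsProper C.hom]
  [GeometricallyIntegral C.hom]

/-- **`Σ_g : C^g → J`, `(τⱼ) ↦ ∏ⱼ α_{R₀}(τⱼ)`, IS SURJECTIVE** for every Jacobian `𝒥` of a smooth projective complex curve with
`dim J ≤ g` (Weil's auxiliary data at `g`; base point `R₀ = R₀(j₀)`).  The image `Z` of the proper `C^g` is closed and irreducible; the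
Albanese factorisation `u : J → Jac` of Weil's `f_J` (★ `descPointed`, `α_{R₀} ≫ u = f_J`) maps `Z` ONTO `Jac` (★ `exists_tuple_prod_comp_fJ_eq`),
so the reduced closed subscheme on `Z` surjects onto `Jac` by a universally closed morphism and `g = dim Jac ≤ dim Z`
(★ `Scheme.topologicalKrullDim_le_of_universallyClosed_of_surjective`); as `dim J ≤ g`, `Z` is not a proper closed subset of the irreducible
`J` (★ `Topology.topologicalKrullDim_lt_of_isClosed_ssubset`).  [Milne1986] Thm. 5.1 (a) «`f^{(g)}` is surjective» / [Lange2023] `W̃_g = J`.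
[cite: Milne1986JacobianVarieties, §5 Thm. 5.1 (a) and §2 Prop. 2.1] [cite: Lange2023AbelianVarietiesComplex, §4.2.1 Lemma 4.2.1] -/
theorem surjective_prod_coord_abelJacobi_baseTuple (hC : IsProjectiveOver C) (hX : CechPseudoCoherentAt C) (g : ℕ)
    (hg : (genus ℂ (curveBC C (strPt (K := ℂ) ℂ)).left.functionField : ℤ) ≤ g)
    (hW : (chartW C g hC).Nonempty) (j₀ : Fin g) (𝒥 : Jacobian C) (hdim : 𝒥.J.dim ≤ g) :
    Function.Surjective (∏ j, coord C g j ≫ 𝒥.abelJacobi (baseTuple C hC hX g hW j₀)).left := by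
  classical
  set R := baseTuple C hC hX g hW j₀ with hR
  set SJ : powC C g ⟶ 𝒥.J.X := ∏ j, coord C g j ≫ 𝒥.abelJacobi R with hSJ
  set SW : powC C g ⟶ (Jac C hC hX g hg hW).X := ∏ j, coord C g j ≫ fJ C hC hX g hg hW j₀ with hSW
  have hfR : R ≫ fJ C hC hX g hg hW j₀ = 1 := baseTuple_comp_fJ C hC hX g hg hW j₀
  set u := 𝒥.descPointed R (fJ C hC hX g hg hW j₀) hfR with hu_def
  have hu : 𝒥.abelJacobi R ≫ u.hom.hom.hom = fJ C hC hX g hg hW j₀ := 𝒥.abelJacobi_descPointed R _ hfR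
  -- `SJ ≫ u = SW`
  have hS : SJ ≫ u.hom.hom.hom = SW := by
    rw [hSJ, hSW, prod_comp_hom]
    simp only [Category.assoc, hu]
  -- properness of the source and of `u`
  haveI hP : IsProper (powC C g).hom := isProper_powOver_base C.hom g
  haveI : IsProper SJ.left := by
    have h : IsProper (SJ.left ≫ 𝒥.J.X.hom) := by rw [Over.w]; exact hP
    exact IsProper.of_comp _ 𝒥.J.X.hom
  haveI : IsProper SW.left := by
    have h : IsProper (SW.left ≫ (Jac C hC hX g hg hW).X.hom) := by rw [Over.w]; exact hP
    exact IsProper.of_comp _ (Jac C hC hX g hg hW).X.hom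
  haveI : IsProper u.hom.hom.hom.left := by
    have h : IsProper (u.hom.hom.hom.left ≫ (Jac C hC hX g hg hW).X.hom) := by rw [Over.w]; infer_instance
    exact IsProper.of_comp _ (Jac C hC hX g hg hW).X.hom
  -- `SW` is surjective (every point of `Jac` is a `g`-fold sum, ★ `exists_tuple_prod_comp_fJ_eq`)
  have hSWsurj : Function.Surjective SW.left := by
    refine surjective_of_isClosed_range_of_forall_exists SW SW.left.isClosedMap.isClosed_range fun b => ?_
    obtain ⟨τ, hτ⟩ := exists_tuple_prod_comp_fJ_eq C hC hX g hg hW j₀ b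
    exact ⟨tuplePt C (strPt (K := ℂ) ℂ) τ, by rw [hSW, tuplePt_comp_prod_coord_fJ, hτ]⟩
  -- the closed image `Z` of `SJ` and its reduced closed subscheme
  set Z : Closeds 𝒥.J.X.left := ⟨Set.range SJ.left.base, SJ.left.isClosedMap.isClosed_range⟩ with hZ
  set ιZ := (Scheme.IdealSheafData.vanishingIdeal Z).subschemeι with hιZ
  have hrangeZ : Set.range ιZ.base = Set.range SJ.left.base := Resolution.range_subschemeι_vanishingIdeal Z
  -- `ιZ ≫ u` is surjective and universally closed, so `dim Jac ≤ dim Z`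
  haveI : Surjective (ιZ ≫ u.hom.hom.hom.left) := by
    refine ⟨fun q => ?_⟩
    obtain ⟨ω, hω⟩ := hSWsurj q
    have hω' : (SJ.left ≫ u.hom.hom.hom.left).base ω = q := by
      rw [← Over.comp_left, hS]; exact hω
    obtain ⟨z, hz⟩ : SJ.left.base ω ∈ Set.range ιZ.base := by rw [hrangeZ]; exact ⟨ω, rfl⟩
    refine ⟨z, ?_⟩
    rw [Scheme.Hom.comp_base, TopCat.coe_comp, Function.comp_apply, hz]
    rw [Scheme.Hom.comp_base, TopCat.coe_comp, Function.comp_apply] at hω'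
    exact hω'
  haveI : UniversallyClosed (ιZ ≫ u.hom.hom.hom.left) := inferInstance
  have hdimZ : topologicalKrullDim (Jac C hC hX g hg hW).X.left ≤ topologicalKrullDim (Scheme.IdealSheafData.vanishingIdeal Z).subscheme :=
    Scheme.topologicalKrullDim_le_of_universallyClosed_of_surjective (ιZ ≫ u.hom.hom.hom.left)
  -- dimensions: `dim Jac = g`, `dim J ≤ g`, `dim (subscheme on Z) = dim Z`
  have hJac : topologicalKrullDim (Jac C hC hX g hg hW).X.left = (g : WithBot ℕ∞) := by
    rw [AbelianVariety.topologicalKrullDim_left, dim_Jac]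
  have hJ : topologicalKrullDim 𝒥.J.X.left ≤ (g : WithBot ℕ∞) := by
    rw [AbelianVariety.topologicalKrullDim_left]; exact_mod_cast hdim
  have hZeq : topologicalKrullDim (Scheme.IdealSheafData.vanishingIdeal Z).subscheme = topologicalKrullDim ↥(Z : Set 𝒥.J.X.left) := by
    let e : ↥(Scheme.IdealSheafData.vanishingIdeal Z).subscheme ≃ₜ ↥(Z : Set 𝒥.J.X.left) :=
      ιZ.isClosedEmbedding.isEmbedding.toHomeomorph.trans (Homeomorph.setCongr (Resolution.range_subschemeι_vanishingIdeal Z))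
    exact IsHomeomorph.topologicalKrullDim_eq e e.isHomeomorph
  -- if `Z ≠ J` its dimension would drop below `g`
  haveI := AbelianVariety.irreducibleSpace_left 𝒥.J
  by_contra hne
  have hZne : (Z : Set 𝒥.J.X.left) ≠ Set.univ := by
    intro h; exact hne (Set.range_eq_univ.mp h)
  have hlt := Literature.Topology.topologicalKrullDim_lt_of_isClosed_ssubset Z.isClosed hZne g
    (lt_of_le_of_lt hJ (by exact_mod_cast Nat.lt_succ_self g))
  rw [← hZeq] at hlt
  exact absurd (hJac.symm.trans_le hdimZ) (not_le.mpr hlt)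

/-- **Every `a ∈ J(ℂ)` is a `g`-fold Abel sum `∏ⱼ α_P(τⱼ)`** (any base point `P`; Weil data explicit, `dim J ≤ g`): `K`-points lift along the
surjective `Σ_g` (★ `AlgPoints.map_surjective_of_surjective_of_isAlgClosed`) and the base point is moved by ★ `prod_comp_abelJacobi_eq_mul_pow`
(the constant `(α_R(P)⁻¹)^g` is absorbed by translating the target point). [cite: Milne1986JacobianVarieties, §5 Thm. 5.1 (a)] -/
theorem exists_tuple_prod_comp_abelJacobi_eq (hC : IsProjectiveOver C) (hX : CechPseudoCoherentAt C) (g : ℕ)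
    (hg : (genus ℂ (curveBC C (strPt (K := ℂ) ℂ)).left.functionField : ℤ) ≤ g)
    (hW : (chartW C g hC).Nonempty) (j₀ : Fin g) (𝒥 : Jacobian C) (hdim : 𝒥.J.dim ≤ g) (P : AlgPoints C ℂ) (a : 𝒥.J.Points ℂ) :
    ∃ τ : Fin g → AlgPoints C ℂ, (∏ j, τ j ≫ 𝒥.abelJacobi P) = a := by
  set R := baseTuple C hC hX g hW j₀ with hR
  haveI : Surjective (∏ j, coord C g j ≫ 𝒥.abelJacobi R).left := ⟨𝒥.surjective_prod_coord_abelJacobi_baseTuple hC hX g hg hW j₀ hdim⟩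
  haveI : LocallyOfFiniteType (powC C g).hom := inferInstance
  set e : 𝒥.J.Points ℂ := ((P ≫ 𝒥.abelJacobi R)⁻¹) ^ g with he
  obtain ⟨ω, hω⟩ := AlgPoints.map_surjective_of_surjective_of_isAlgClosed' (L := ℂ) (∏ j, coord C g j ≫ 𝒥.abelJacobi R) (a * e⁻¹)
  refine ⟨fun j => ω ≫ coord C g j, ?_⟩
  rw [𝒥.prod_comp_abelJacobi_eq_mul_pow R P, ← he, ← 𝒥.comp_prod_coord_abelJacobi R ω]
  change AlgPoints.map (∏ j, coord C g j ≫ 𝒥.abelJacobi R) ω * e = a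
  rw [hω, inv_mul_cancel_right]

/-! ## §3 The socket `hopen` for an abstract complex Jacobian -/

/-- **`hopen` for an ABSTRACT complex Jacobian** (Weil's auxiliary data explicit, `dim J ≤ g`): a non-empty open `U₁ ⊆ J` such that every
`a ∈ J(ℂ)` with `a.pt ∈ U₁` is the Abel sum `∏ⱼ α_P(τⱼ)` of `g` DISTINCT points, unique up to a permutation.  EXISTENCE: §2; INJECTIVITY and
UNIQUENESS: transport of ★ `WeilJacobian.exists_opens_general_sum` (A-p03 (g13)) along `u : J → Jac` (★ `prod_comp_fJ_eq_of_prod_comp_abelJacobi_eq`),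
with `U₁ := (t_{e⁻¹} ≫ u)⁻¹ U`.  This is the hypothesis `hopen` of ★ `Jacobian.exists_open_ajSum_classPullback_shear_of_leaves` at `Fin g`.
[cite: Milne1986JacobianVarieties, §5 Thm. 5.1 (a), §6 Prop. 6.1 and Lemma 6.7] [cite: Lange2023AbelianVarietiesComplex, §4.4.2 Lemma 4.4.4 (Step I)] -/
theorem exists_opens_general_abelSum (hC : IsProjectiveOver C) (hX : CechPseudoCoherentAt C) (g : ℕ)
    (hg : (genus ℂ (curveBC C (strPt (K := ℂ) ℂ)).left.functionField : ℤ) ≤ g)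
    (hW : (chartW C g hC).Nonempty) (j₀ : Fin g) (𝒥 : Jacobian C) (hdim : 𝒥.J.dim ≤ g) (P : AlgPoints C ℂ) :
    ∃ U₁ : 𝒥.J.X.left.Opens, (U₁ : Set 𝒥.J.X.left).Nonempty ∧
      ∀ a : 𝒥.J.Points ℂ, a.pt ∈ U₁ →
        ∃ τ : Fin g → AlgPoints C ℂ, Function.Injective τ ∧ (∏ j, τ j ≫ 𝒥.abelJacobi P) = a ∧
          ∀ τ' : Fin g → AlgPoints C ℂ, (∏ j, τ' j ≫ 𝒥.abelJacobi P) = a →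
            ∃ σ : Equiv.Perm (Fin g), τ' = τ ∘ σ := by
  set R := baseTuple C hC hX g hW j₀ with hR
  have hfR : R ≫ fJ C hC hX g hg hW j₀ = 1 := baseTuple_comp_fJ C hC hX g hg hW j₀
  set u := 𝒥.descPointed R (fJ C hC hX g hg hW j₀) hfR with hu_def
  obtain ⟨U, hU, hgen⟩ := exists_opens_general_sum C hC hX g hg hW j₀
  set e : 𝒥.J.Points ℂ := ((P ≫ 𝒥.abelJacobi R)⁻¹) ^ g with he
  set φ : 𝒥.J.X.left ⟶ (Jac C hC hX g hg hW).X.left := (𝒥.J.translation e⁻¹).left ≫ u.hom.hom.hom.left with hφ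
  -- surjectivity of `φ` (for non-emptiness): `u` is surjective on points since `u ∘ Σ_g = Σ_W` is
  have husurj : Function.Surjective u.hom.hom.hom.left := by
    intro q
    haveI hP : IsProper (powC C g).hom := isProper_powOver_base C.hom g
    set SW : powC C g ⟶ (Jac C hC hX g hg hW).X := ∏ j, coord C g j ≫ fJ C hC hX g hg hW j₀ with hSW
    haveI : IsProper SW.left := by
      have h : IsProper (SW.left ≫ (Jac C hC hX g hg hW).X.hom) := by rw [Over.w]; exact hP
      exact IsProper.of_comp _ (Jac C hC hX g hg hW).X.hom
    have hSWsurj : Function.Surjective SW.left := by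
      refine surjective_of_isClosed_range_of_forall_exists SW SW.left.isClosedMap.isClosed_range fun b => ?_
      obtain ⟨τ, hτ⟩ := exists_tuple_prod_comp_fJ_eq C hC hX g hg hW j₀ b
      exact ⟨tuplePt C (strPt (K := ℂ) ℂ) τ, by rw [hSW, tuplePt_comp_prod_coord_fJ, hτ]⟩
    obtain ⟨ω, hω⟩ := hSWsurj q
    refine ⟨(∏ j, coord C g j ≫ 𝒥.abelJacobi R).left.base ω, ?_⟩
    have h : (∏ j, coord C g j ≫ 𝒥.abelJacobi R) ≫ u.hom.hom.hom = SW := by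
      rw [hSW, prod_comp_hom]; simp only [Category.assoc, hu_def, 𝒥.abelJacobi_descPointed R _ hfR]
    rw [← Scheme.Hom.comp_apply, ← Over.comp_left, h]
    exact hω
  refine ⟨φ ⁻¹ᵁ U, ?_, fun a ha => ?_⟩
  · obtain ⟨p, hp⟩ := hU
    obtain ⟨q, hq⟩ := husurj p
    obtain ⟨q', hq'⟩ := (Scheme.homeoOfIso (asIso (𝒥.J.translation e⁻¹).left)).surjective q
    refine ⟨q', ?_⟩
    change (φ.base q') ∈ (U : Set _)
    rw [hφ, Scheme.Hom.comp_base, TopCat.coe_comp, Function.comp_apply]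
    change u.hom.hom.hom.left.base ((Scheme.homeoOfIso (asIso (𝒥.J.translation e⁻¹).left)) q') ∈ (U : Set _)
    rw [hq', hq]; exact hp
  · -- the point `b := u(e⁻¹ a)` lies over `U`
    set b : specOver ℂ ℂ ⟶ (Jac C hC hX g hg hW).X := (e⁻¹ * a) ≫ u.hom.hom.hom with hb
    have hbpt : AlgPoints.pt b = φ.base a.pt := by
      rw [hφ, Scheme.Hom.comp_base, TopCat.coe_comp, Function.comp_apply]
      change AlgPoints.pt b = u.hom.hom.hom.left ((𝒥.J.translation e⁻¹).left (AlgPoints.pt a))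
      rw [AbelianVariety.translation_apply_pt]
      rfl
    have hbU : AlgPoints.pt b ∈ U := by rw [hbpt]; exact ha
    obtain ⟨τW, hτWinj, hτW, huniq⟩ := hgen b hbU
    -- `∏ⱼ α_P(τⱼ) = a  →  ∏ⱼ f_J(τⱼ) = b`
    have hfwd : ∀ τ₁ : Fin g → AlgPoints C ℂ, (∏ j, τ₁ j ≫ 𝒥.abelJacobi P) = a →
        (∏ j, τ₁ j ≫ fJ C hC hX g hg hW j₀) = b := by
      intro τ₁ h
      have h1 : (∏ j, τ₁ j ≫ 𝒥.abelJacobi R) = e⁻¹ * a := by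
        rw [𝒥.prod_comp_abelJacobi_eq_mul_pow R P τ₁, ← he] at h
        rw [← h, mul_comm _ e, ← _root_.mul_assoc, inv_mul_cancel, _root_.one_mul]
      rw [hb, ← h1, prod_comp_hom]
      simp only [Category.assoc, hu_def, 𝒥.abelJacobi_descPointed R _ hfR]
    -- existence in `J` (§2), then identification with Weil's tuple up to permutation
    obtain ⟨τ₀, hτ₀⟩ := 𝒥.exists_tuple_prod_comp_abelJacobi_eq hC hX g hg hW j₀ hdim P a
    obtain ⟨σ₀, hσ₀⟩ := huniq τ₀ (hfwd τ₀ hτ₀)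
    refine ⟨τ₀, ?_, hτ₀, fun τ' hτ' => ?_⟩
    · rw [hσ₀]; exact hτWinj.comp σ₀.injective
    · obtain ⟨σ', hσ'⟩ := huniq τ' (hfwd τ' hτ')
      refine ⟨σ₀⁻¹ * σ', ?_⟩
      rw [hσ', hσ₀]
      ext i
      simp [Function.comp_apply]

/-- **`hopen` with Weil's auxiliary data discharged** (`g := curveGenus C ≥ 1`; `dim J ≤ g` by ★ `Jacobian.dim_le_curveGenus`, Hodge theory):
the form the G4 skeleton's `stub_open` consumes, at `Fin (curveGenus C)`.
[cite: Milne1986JacobianVarieties, §5 Thm. 5.1 (a), §6 Lemma 6.7 and §2 Prop. 2.1] [cite: Lange2023AbelianVarietiesComplex, §4.4.2 Lemma 4.4.4 (Step I)] -/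
theorem exists_opens_general_abelSum' (hC' : IsSmoothProjective 1 C) (𝒥 : Jacobian C) (hpos : 1 ≤ curveGenus C) (P : AlgPoints C ℂ) :
    ∃ U₁ : 𝒥.J.X.left.Opens, (U₁ : Set 𝒥.J.X.left).Nonempty ∧
      ∀ a : 𝒥.J.Points ℂ, a.pt ∈ U₁ →
        ∃ τ : Fin (curveGenus C) → AlgPoints C ℂ, Function.Injective τ ∧ (∏ j, τ j ≫ 𝒥.abelJacobi P) = a ∧
          ∀ τ' : Fin (curveGenus C) → AlgPoints C ℂ, (∏ j, τ' j ≫ 𝒥.abelJacobi P) = a →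
            ∃ σ : Equiv.Perm (Fin (curveGenus C)), τ' = τ ∘ σ := by
  have hC : IsProjectiveOver C := hC'.isProjectiveOver
  have hX : CechPseudoCoherentAt C := cechPseudoCoherentAt_of_general cechComplex_pseudoCoherent_general_holds C
  have hg : (genus ℂ (curveBC C (strPt (K := ℂ) ℂ)).left.functionField : ℤ) ≤ curveGenus C := by
    exact_mod_cast (curveGenus_curveBC C (strPt (K := ℂ) ℂ)).le
  haveI := infinite_algPoints C
  let emb := Infinite.natEmbedding (AlgPoints C ℂ)
  let s : Fin (2 * curveGenus C) → (𝟙_ (SchemeOver ℂ) ⟶ C) := fun j ↦ unitToSpecOver ℂ ≫ emb j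
  have hs : Function.Injective s := fun j₁ j₂ h ↦ by
    have h' := congrArg (toUnit (specOver ℂ ℂ) ≫ ·) h
    simp only [s] at h'
    rw [← Category.assoc, toUnit_unitToSpecOver, Category.id_comp, ← Category.assoc, toUnit_unitToSpecOver,
      Category.id_comp] at h'
    exact Fin.val_injective (emb.injective h')
  have hW : (chartW C (curveGenus C) hC).Nonempty :=
    chartW_nonempty C (curveGenus C) hC (nonempty_generalLocus_of_sections C s hs (by omega))
  exact 𝒥.exists_opens_general_abelSum hC hX (curveGenus C) hg hW ⟨0, by omega⟩ (Literature.AlgebraicGeometry.HodgeTheory.Jacobian.dim_le_curveGenus (C := C) hC' 𝒥) P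

/-! ## §4 The socket in the exact shape of GLUE III (`JacobianGaloisCoverNormAdjointOfThreeLeaves`) -/

/-- **`hopen` IN THE SHAPE OF ★ GLUE III** (`Jacobian.galoisCover_pullback_isWeilPairingAdjoint_norm_of_three_leaves`, binder `hopen`, token for
token up to the leading `∀ {C} [IsIntegral C.left] [IsLocallyNoetherian C.left] (𝒥)`): for a smooth projective complex curve with a Jacobian of
dimension `≥ 1` and any base point, the `(dim J − 1 + 1)`-fold Abel sums of injective tuples fill a non-empty open of `J`, uniquely up to order.
(`dim J = g(C)`: ★ `HodgeTheory.Jacobian.dim_le_curveGenus` + ★ `curveGenus_le_jacobian_dim`; instances from ★ `IsSmoothProjective.isProper_holds` ∕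
`geometricallyIntegral_holds`.) [cite: Milne1986JacobianVarieties, §5 Thm. 5.1 (a), §6 Lemma 6.7 and §2 Prop. 2.1]
[cite: Lange2023AbelianVarietiesComplex, §4.4.2 Lemma 4.4.4 (Step I)] -/
theorem exists_opens_general_abelSum_of_isSmoothProjective {C : SchemeOver ℂ} [IsIntegral C.left] [IsLocallyNoetherian C.left]
    (𝒥 : Jacobian C) (hC : IsSmoothProjective 1 C) (hdim : 1 ≤ 𝒥.J.dim) (c : AlgPoints C ℂ) :
    ∃ U₁ : 𝒥.J.X.left.Opens, (U₁ : Set 𝒥.J.X.left).Nonempty ∧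
      ∀ a : 𝒥.J.Points ℂ, a.pt ∈ U₁ → ∃ τ : Fin (𝒥.J.dim - 1 + 1) → AlgPoints C ℂ, Function.Injective τ ∧
        (∏ j : Fin (𝒥.J.dim - 1 + 1), τ j ≫ 𝒥.abelJacobi c) = a ∧
        ∀ τ' : Fin (𝒥.J.dim - 1 + 1) → AlgPoints C ℂ, (∏ j : Fin (𝒥.J.dim - 1 + 1), τ' j ≫ 𝒥.abelJacobi c) = a →
          ∃ σ : Equiv.Perm (Fin (𝒥.J.dim - 1 + 1)), τ' = τ ∘ σ := by
  haveI : SmoothOfRelativeDimension 1 C.hom := hC.smoothOfRelativeDimension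
  haveI : IsProper C.hom := IsSmoothProjective.isProper_holds hC
  haveI : GeometricallyIntegral C.hom := IsSmoothProjective.geometricallyIntegral_holds hC
  have hproj : IsProjectiveOver C := hC.isProjectiveOver
  have hX : CechPseudoCoherentAt C := cechPseudoCoherentAt_of_general cechComplex_pseudoCoherent_general_holds C
  have hle : 𝒥.J.dim ≤ curveGenus C := Literature.AlgebraicGeometry.HodgeTheory.Jacobian.dim_le_curveGenus (C := C) hC 𝒥
  have hge : curveGenus C ≤ 𝒥.J.dim := curveGenus_le_jacobian_dim C hproj 𝒥
  have hg' : curveGenus C = 𝒥.J.dim - 1 + 1 := by omega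
  have hg : (genus ℂ (curveBC C (strPt (K := ℂ) ℂ)).left.functionField : ℤ) ≤ ((𝒥.J.dim - 1 + 1 : ℕ) : ℤ) := by
    have h := (curveGenus_curveBC C (strPt (K := ℂ) ℂ)).le
    rw [hg'] at h
    exact_mod_cast h
  -- the chart `W` at `g = curveGenus C` is non-empty (`2g − 1` distinct points), transported to the index `dim J − 1 + 1`
  haveI := infinite_algPoints C
  let emb := Infinite.natEmbedding (AlgPoints C ℂ)
  let s : Fin (2 * curveGenus C) → (𝟙_ (SchemeOver ℂ) ⟶ C) := fun j ↦ unitToSpecOver ℂ ≫ emb j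
  have hs : Function.Injective s := fun j₁ j₂ h ↦ by
    have h' := congrArg (toUnit (specOver ℂ ℂ) ≫ ·) h
    simp only [s] at h'
    rw [← Category.assoc, toUnit_unitToSpecOver, Category.id_comp, ← Category.assoc, toUnit_unitToSpecOver,
      Category.id_comp] at h'
    exact Fin.val_injective (emb.injective h')
  have hW0 : (chartW C (curveGenus C) hproj).Nonempty :=
    chartW_nonempty C (curveGenus C) hproj (nonempty_generalLocus_of_sections C s hs (by omega))
  have hW : (chartW C (𝒥.J.dim - 1 + 1) hproj).Nonempty := by rw [← hg']; exact hW0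
  exact 𝒥.exists_opens_general_abelSum hproj hX (𝒥.J.dim - 1 + 1) hg hW ⟨0, by omega⟩ (by omega) c

end Jacobian

end Literature.AlgebraicGeometry.Motives

end
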